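import Mathlib
import Summits.ABC.IUTFork.Joshi.LocalPeriodRingsModelTower
import Summits.ABC.IUTFork.Joshi.ThetaJoshiAdelicPeriodBridge
import HarnessLib

/-!
# The residual hypotheses of [J-III] Thm. 6.7.1 over the §5 period rings DISCHARGED at the tower model, and T-11's
# conditional Thm. 6.7.1 INSTANTIATED (companion of `LocalPeriodRingsModelTower.lean` p438686 / `ThetaJoshiAdelicPeriodBridge.lean` p436830)

Test-side support file of the abc-iut cell, branch E (rung LADDER-ABC:A2.E; seat abc-iut-E-t9 gen 2, authors-first companion
per E-plan-2 RE-SEAT POLICY 2026-08-26T09:48:21Z (2)). Source numbering: K. Joshi, *Construction of Arithmetic Teichmüller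
Spaces III*, arXiv:2401.13508v4 (bib `Joshi2024ATS3`), §5–§6.7; locators «p.N l.M» = the cell's render.

WHAT IS DISCHARGED. Slot T-11's bridge `Summit.ABC.IUTFork.Joshi.ATS3.AdelicLiftDatum.thm671_of_periodRings` (p436830) derives
[J-III] Thm. 6.7.1 (Galois-, `φ`- and `Aut(G_E)`-stability of the basic theta-values locus, p.49 l.86 – p.50 l.3) over the T-09
rings MODULO, at every place, five named residual hypotheses on the datum `ℰ : BEDatum` (the `p`-adic field `E ⊃ E_0` and the
Frobenius `φ_{B_E}`, [J-III] §5.2.3, §5.3.2): `hO` (the scalars `O → B_E` land in `E`), `hcont` (every `galBE g`, `g ∈ G_E`, is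
continuous), `hφc` / `hφc'` (`φ_{B_E}` and `φ_{B_E}⁻¹` are continuous) for SOME topology on `B_E` — print: the Fréchet topology,
§5.3.3 p.41 l.35–39, typed by no slot —, and `hcomm` (`[G_E, φ_{B_E}] = 0`). This file PROVES all five, simultaneously, at ONE
place over the kernel model `Summit.ABC.IUTFork.Joshi.Model.towerBEDatum p` of p438686 (`B = Q̄_p[ℚ][S]`, `B_dR = K′((S))`,
`E = E_0 = ℚ_p ⊂ B⁺`, `G` trivial, `φ = (S ↦ p·S)`), for the `S`-adic topology that Mathlib's `LaurentSeries.valued` puts on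
`K′((S)) ⊃ B_E` and the scalars `O := E = ℚ_p` («use `O = O_E` or `E`», p436830 §B), and then FEEDS them to T-11's constructor:
* §1 an isometry lemma for Laurent series: power series with the same pattern of vanishing coefficients have the same
  `S`-adic valuation; hence `a(S) ↦ a(u·S)` (`PowerSeries.rescale u`, `u ≠ 0`) preserves the valuation;
* §2 the model `B_E`: its elements are the polynomials, `φ_{B_E}` acts as `φ_{B_dR}` on them, `G_E` acts trivially;
* §3 (`hcont`, `hφc`, `hφc'`) an additive self-map of a subalgebra of a valued field that preserves the valuation is continuous;
  `φ_{B_E}^{±1}` preserve the `S`-adic valuation (§1) — an isometry argument, not a discrete-topology dodge; `galBE g = id`;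
* §4 (`hO`, `hcomm`) scalars `ℚ_p → B_E` land in `E = ℚ_p`; `galBE g ∘ φ_{B_E} = φ_{B_E} ∘ galBE g`; T-11's §B linearity lemmas
  `galBE_smul` / `frobBE_smul` then apply BY NAME with these scalars;
* §5 the five residuals packaged in the exact shapes of p436830's binders (one place);
* §6 the remaining DATA of p436830 §C–§D supplied — a one-place collation datum, DEGENERATE lift data of slot T-10's signature
  (`[z] = 1`, norms `≡ 1`, trivial absolute value on `K_{y′}`), and a WITNESS of T-09's claim (5.2.5.4) `B̃_E ≃ B_E^{⊕[E_0:ℚ_p]}` at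
  `E = E_0 = ℚ_p` (generic: `BEDatum.splitOfBot`) —, so that `AdelicLiftDatum.ofPeriodRings` REALISES an adelic lift family on the
  model carriers and `thm671_ofPeriodRings_mulActionBE` yields `thm671_towerModel : (modelAdelic p l).Thm671 _` with NO
  hypothesis left.
UPSHOT (registry wording): the residual hypotheses of T-11's conditional Thm. 6.7.1 are JOINTLY SATISFIABLE with the typed §5
tower (p429989) and E-t3's §2 signature in one kernel model, and the whole conditional derivation p430072 → p436830 is
INSTANTIATED end to end (a nonempty class; Thm. 6.7.1 (1)(2)(3) is a hypothesis-free kernel theorem for that instance). HONEST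
SCOPE: a LOGICAL model (as p436997/p438686: `|t|_ρ = 0` there, E-t50 INFO 1) with degenerate lift data; nothing is claimed
about the Fréchet topology of [FF18]'s `B_E`, about `[G_E, φ_E] = 0` for the genuine `B ⊗_{E_0} E`, about theta values, or about
any author's mathematics. TAKES NO SIDE on [IUTchIII] Cor. 3.12; typed ≠ proved ≠ endorsed; NO abc claim. No `Prop` definition,
no instance (two `open Classical in` for an `if`), no FACT-LIST row, 0 `sorry`. [folklore]
bears_on: LADDER-ABC:A2.E
-/

noncomputable section

open Polynomial

namespace Summit.ABC.IUTFork.Joshi.Model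

/-! ## §1 An `S`-adic isometry lemma for Laurent series -/

section Laurent

variable {K : Type*} [Field K]

/-- Two power series whose coefficients vanish in the same degrees have the same `S`-adic valuation in `K((S))` (Mathlib:
the valuation is read off from the vanishing of low coefficients, `LaurentSeries.valuation_le_iff_coeff_lt_log_eq_zero`). [folklore] -/
theorem valuation_coe_eq_of_coeff_eq_zero_iff (a b : PowerSeries K)
    (h : ∀ n, PowerSeries.coeff n a = 0 ↔ PowerSeries.coeff n b = 0) :
    Valued.v (a : LaurentSeries K) = Valued.v (b : LaurentSeries K) := by
  have key : ∀ D : WithZero (Multiplicative ℤ), D ≠ 0 →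
      (Valued.v (a : LaurentSeries K) ≤ D ↔ Valued.v (b : LaurentSeries K) ≤ D) := fun D hD => by
    rw [LaurentSeries.valuation_le_iff_coeff_lt_log_eq_zero K hD,
      LaurentSeries.valuation_le_iff_coeff_lt_log_eq_zero K hD]
    refine forall₂_congr fun n _ => ?_
    rw [PowerSeries.coeff_coe, PowerSeries.coeff_coe]
    split_ifs
    · exact Iff.rfl
    · exact h _
  have hzero : a = 0 ↔ b = 0 := by
    constructor <;> intro h0 <;> ext n <;> rw [map_zero]
    · exact (h n).1 (by rw [h0, map_zero])
    · exact (h n).2 (by rw [h0, map_zero])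
  by_cases ha : a = 0
  · rw [ha, hzero.1 ha]
  · have hb : b ≠ 0 := fun hb => ha (hzero.2 hb)
    have hva : Valued.v (a : LaurentSeries K) ≠ 0 := by
      rw [Ne, Valuation.zero_iff]
      exact fun h0 => ha (HahnSeries.ofPowerSeries_injective (by rw [h0, map_zero]))
    have hvb : Valued.v (b : LaurentSeries K) ≠ 0 := by
      rw [Ne, Valuation.zero_iff]
      exact fun h0 => hb (HahnSeries.ofPowerSeries_injective (by rw [h0, map_zero]))
    exact le_antisymm ((key _ hvb).2 le_rfl) ((key _ hva).1 le_rfl)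

/-- The substitution `a(S) ↦ a(u·S)` (`u ≠ 0`) preserves the `S`-adic valuation of a power series in `K((S))`. [folklore] -/
theorem valuation_coe_rescale {u : K} (hu : u ≠ 0) (a : PowerSeries K) :
    Valued.v ((PowerSeries.rescale u a : PowerSeries K) : LaurentSeries K) = Valued.v (a : LaurentSeries K) :=
  valuation_coe_eq_of_coeff_eq_zero_iff _ _ fun n => by
    rw [PowerSeries.coeff_rescale, mul_eq_zero, or_iff_right (pow_ne_zero n hu)]

end Laurent

variable (p : ℕ) [hp : Fact p.Prime]

/-! ## §2 The model `B_E = B_{ℚ_p} = B ⊂ B_dR`: elements, `φ_{B_E}`, `G_E` -/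

/-- Every element of the model `B_E` is (the image of) a polynomial `f ∈ B = Q̄_p[ℚ][S]`. [folklore] -/
theorem exists_toBdRAlg_eq (x : (towerModel p).BE ⊥) : ∃ f : TowerRing p, toBdRAlg p f = (x : Omega p) :=
  (AlgHom.mem_range _).1 ((BE_bot_eq p).le x.2)

/-- **`φ_{B_E}` acts as `φ_{B_dR} = (S ↦ p·S)` on elements** (unfolding of p438686's transported `frobBE`). [folklore] -/
theorem coe_frobBE (x : (towerModel p).BE ⊥) :
    (((towerBEDatum p).frobBE x : (towerModel p).BE ⊥) : Omega p) = frobΩ p (x : Omega p) := by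
  obtain ⟨f, hf⟩ := exists_toBdRAlg_eq p x
  have h1 : Subalgebra.equivOfEq _ _ (BE_bot_eq p) x = rangeEquiv p f :=
    Subtype.ext (by rw [rangeEquiv, AlgEquiv.ofInjective_apply, hf]; rfl)
  show ((frobBE p x : (towerModel p).BE ⊥) : Omega p) = _
  rw [frobBE, AlgEquiv.trans_apply, AlgEquiv.trans_apply, AlgEquiv.trans_apply, AlgEquiv.trans_apply, h1,
    AlgEquiv.symm_apply_apply]
  show ((rangeEquiv p (frobEquivA p f) : (toBdRAlg p).range) : Omega p) = _
  rw [rangeEquiv, AlgEquiv.ofInjective_apply, ← hf, frobΩ_toBdR]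

/-- `G_E` acts trivially on the model `B_E` (the model's Galois action on `B_dR` is trivial). [folklore] -/
theorem galBE_eq_self (g : (towerBEDatum p).GE) (x : (towerModel p).BE ⊥) : (towerBEDatum p).galBE g x = x :=
  Subtype.ext (by rw [ATS3.PeriodRingTower.BEDatum.coe_galBE]; rfl)

/-! ## §3 `hcont`, `hφc`, `hφc'`: continuity for the `S`-adic topology of `B_dR = K′((S))` -/

/-- An additive self-map of a subalgebra of the valued field `B_dR` that PRESERVES the valuation is continuous (subspace
topology). [folklore] -/
theorem continuous_of_valuation_eq {S : Subalgebra ℚ_[p] (Omega p)} (f : S → S)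
    (hsub : ∀ x y : S, f (x - y) = f x - f y)
    (hv : ∀ z : S, Valued.v ((f z : S) : Omega p) = Valued.v (z : Omega p)) : Continuous f := by
  refine continuous_iff_continuousAt.2 fun x => ?_
  rw [ContinuousAt, Filter.tendsto_def]
  intro s hs
  obtain ⟨t, ht, hts⟩ := (mem_nhds_subtype _ (f x) s).1 hs
  obtain ⟨γ, hγ⟩ := Valued.mem_nhds.1 ht
  refine (mem_nhds_subtype _ x _).2
    ⟨{y | Valued.v.restrict (y - (x : Omega p)) < γ.1}, Valued.mem_nhds.2 ⟨γ, subset_rfl⟩, fun y hy => hts (hγ ?_)⟩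
  rw [Set.mem_preimage, Set.mem_setOf_eq, Valuation.restrict_lt_iff_lt_embedding] at hy
  rw [Set.mem_setOf_eq, Valuation.restrict_lt_iff_lt_embedding, ← Subalgebra.coe_sub, ← hsub, hv, Subalgebra.coe_sub]
  exact hy

/-- **`φ_{B_E}` preserves the `S`-adic valuation** (`φ = (S ↦ p·S)` and `p` is a non-zero constant). [folklore] -/
theorem valuation_coe_frobBE (z : (towerModel p).BE ⊥) :
    Valued.v (((towerBEDatum p).frobBE z : (towerModel p).BE ⊥) : Omega p) = Valued.v (z : Omega p) := by
  obtain ⟨f, hf⟩ := exists_toBdRAlg_eq p z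
  rw [coe_frobBE, ← hf, toBdRAlg_apply, toBdRRingHom_apply, frobΩ_apply, frobΩRingHom_ofPowerSeries]
  exact valuation_coe_rescale (natCast_p_ne_zero_coef p) _

/-- … and so does `φ_{B_E}⁻¹`. [folklore] -/
theorem valuation_coe_frobBE_symm (z : (towerModel p).BE ⊥) :
    Valued.v (((towerBEDatum p).frobBE.symm z : (towerModel p).BE ⊥) : Omega p) = Valued.v (z : Omega p) := by
  conv_rhs => rw [← (towerBEDatum p).frobBE.apply_symm_apply z]
  rw [valuation_coe_frobBE]

/-- **`hφc` at the model**: `φ_{B_E}` is continuous. [folklore] -/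
theorem continuous_frobBE : Continuous (towerBEDatum p).frobBE :=
  continuous_of_valuation_eq p (S := (towerModel p).BE ⊥) (fun x => frobBE p x) (fun x y => map_sub (frobBE p) x y)
    (valuation_coe_frobBE p)

/-- **`hφc'` at the model**: `φ_{B_E}⁻¹` is continuous. [folklore] -/
theorem continuous_frobBE_symm : Continuous (towerBEDatum p).frobBE.symm :=
  continuous_of_valuation_eq p (S := (towerModel p).BE ⊥) (fun x => (frobBE p).symm x)
    (fun x y => map_sub (frobBE p).symm x y) (valuation_coe_frobBE_symm p)

/-- **`hcont` at the model**: every `galBE g` (`g ∈ G_E`) is continuous. [folklore] -/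
theorem continuous_galBE (g : (towerBEDatum p).GE) : Continuous ((towerBEDatum p).galBE g) :=
  continuous_id.congr fun x => (galBE_eq_self p g x).symm

/-! ## §4 `hO` and `hcomm` -/

/-- **`hO` at the model** with scalars `O := E = ℚ_p`: the structure map `ℚ_p → B_E` lands in `E`. [folklore] -/
theorem algebraMap_coe_mem_E (q : ℚ_[p]) :
    ((algebraMap ℚ_[p] ((towerModel p).BE ⊥) q : (towerModel p).BE ⊥) : Omega p) ∈ (towerBEDatum p).E :=
  (⊥ : IntermediateField ℚ_[p] (Omega p)).algebraMap_mem q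

/-- **`hcomm` at the model**: `galBE g (φ x) = φ (galBE g x)`. [folklore] -/
theorem galBE_frobBE_comm (g : (towerBEDatum p).GE) (x : (towerModel p).BE ⊥) :
    (towerBEDatum p).galBE g ((towerBEDatum p).frobBE x) = (towerBEDatum p).frobBE ((towerBEDatum p).galBE g x) := by
  rw [galBE_eq_self, galBE_eq_self]

/-- T-11's §B `frobBE_smul` (p436830) CONSUMED BY NAME with the model scalars: `φ_{B_E}` is `ℚ_p`-linear. [folklore] -/
theorem frobBE_smul_model (c : ℚ_[p]) (x : (towerModel p).BE ⊥) :
    (towerBEDatum p).frobBE (c • x) = c • (towerBEDatum p).frobBE x :=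
  (towerBEDatum p).frobBE_smul (algebraMap_coe_mem_E p) c x

/-- T-11's §B `galBE_smul` (p436830) CONSUMED BY NAME with the model scalars: `G_E ↷ B_E` is `ℚ_p`-linear. [folklore] -/
theorem galBE_smul_model (g : (towerBEDatum p).GE) (c : ℚ_[p]) (x : (towerModel p).BE ⊥) :
    (towerBEDatum p).galBE g (c • x) = c • (towerBEDatum p).galBE g x :=
  (towerBEDatum p).galBE_smul (algebraMap_coe_mem_E p) g c x

/-! ## §5 The five residual hypotheses of `thm671_of_periodRings`, jointly, at one place -/

/-- **NON-VACUITY of the residuals of T-11's conditional [J-III] Thm. 6.7.1** (`AdelicLiftDatum.thm671_of_periodRings`,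
p436830): at the model datum `towerBEDatum p` — for every prime `p` — the hypotheses `hO` (scalars `O := ℚ_p = E`), `hcont`,
`hφc`, `hφc'` (for the `S`-adic topology of `B_dR = K′((S))`) and `hcomm` hold SIMULTANEOUSLY, in the binder shapes of p436830
with the place index dropped. A logical model: satisfiability of the typed residuals together with the §5 tower and the §2
signature, nothing more. [folklore] -/
theorem thm671_residuals_towerModel :
    (∀ c : ℚ_[p], ((algebraMap ℚ_[p] ((towerModel p).BE ⊥) c : (towerModel p).BE ⊥) : Omega p) ∈ (towerBEDatum p).E) ∧
    (∀ g : (towerBEDatum p).GE, Continuous ((towerBEDatum p).galBE g)) ∧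
    Continuous (towerBEDatum p).frobBE ∧ Continuous (towerBEDatum p).frobBE.symm ∧
    (∀ (g : (towerBEDatum p).GE) (x : (towerModel p).BE ⊥),
      (towerBEDatum p).galBE g ((towerBEDatum p).frobBE x) = (towerBEDatum p).frobBE ((towerBEDatum p).galBE g x)) :=
  ⟨algebraMap_coe_mem_E p, continuous_galBE p, continuous_frobBE p, continuous_frobBE_symm p, galBE_frobBE_comm p⟩

end Summit.ABC.IUTFork.Joshi.Model

/-! ## §6 T-11's conditional Thm. 6.7.1 INSTANTIATED: `Thm671` holds, unconditionally, for a realised family over the model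

With the residuals discharged, the remaining inputs of `AdelicLiftDatum.thm671_ofPeriodRings_mulActionBE` (p436830 §D) are DATA:
a collation datum `A` (§6.3), slot T-10's lift data over `B_E` at every place (`LiftInput`), and a witness `e` of T-09's claim
(5.2.5.4) `B̃_E ≃ B_E^{⊕[E_0:ℚ_p]}`. All three are constructible over the model (one place; `Y = {pt}`; `E = E_0 = ℚ_p`), so T-11's
constructor `ofPeriodRings` yields an adelic lift family on the T-09 carriers for which [J-III] Thm. 6.7.1 (1)(2)(3) is a
THEOREM of the kernel with no hypothesis left — the conditional derivation p430072 → p436830 speaks about a nonempty class.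
The lift data are DEGENERATE placeholders (`[z] = 1`, all norms `≡ 1`): satisfiability of the typed signature, nothing about
theta values. §6a–§6b are generic (abstract carriers, cheap elaboration); §6c instantiates. -/

/-! ### §6a (generic, over slot T-09's signature) a witness of (5.2.5.4) when `E = E_0 = ℚ_p` -/

namespace Summit.ABC.IUTFork.Joshi.ATS3.PeriodRingTower

variable {F B E0 : Type} [Field F] [CommRing B] [Field E0] {Y : Type} {K : Y → Type} [∀ y, Field (K y)]
  {G : Type} [Group G] {D : PeriodRingDatum F B E0 Y K G} {p : ℕ} [Fact p.Prime] [Algebra ℚ_[p] B] {Ω : Type}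
  [Field Ω] [Algebra ℚ_[p] Ω] {T : PeriodRingTower D p Ω}

variable (T) in
/-- `B_{ℚ_p} = B` inside `B_dR` ((5.2.4.1) at `E = ℚ_p`). [folklore] -/
theorem BE_bot_eq_range : T.BE ⊥ = T.toBdR.range := by
  rw [BE, IntermediateField.bot_toSubalgebra, sup_bot_eq]

namespace BEDatum

variable (ℰ : T.BEDatum)

/-- The diagonal `B_E ≃ B_E^{⊕[E_0:ℚ_p]}` when `[E_0 : ℚ_p] = 1`. [folklore] -/
def diagOfEqOne (hf : ℰ.f = 1) : T.BE ℰ.E ≃ₐ[ℚ_[p]] (Fin ℰ.f → T.BE ℰ.E) where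
  toFun x _ := x
  invFun v := v ⟨0, by rw [hf]; exact Nat.one_pos⟩
  left_inv _ := rfl
  right_inv v := funext fun i => by
    have hi : i = ⟨0, by rw [hf]; exact Nat.one_pos⟩ := Fin.ext (Nat.lt_one_iff.1 (lt_of_lt_of_eq i.2 hf))
    rw [hi]
  map_mul' _ _ := rfl
  map_add' _ _ := rfl
  commutes' _ := rfl

/-- **A witness of T-09's claim (5.2.5.4) `BtildeSplits` when `E = E_0 = ℚ_p`**: `B̃_E = B ⊗_{ℚ_p} ℚ_p ≃ B ≃ B_{ℚ_p} ≃ B_E^{⊕ 1}`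
(Mathlib `TensorProduct.rid`, (5.2.4.2) injectivity, the diagonal). [folklore] -/
def splitOfBot (hE : ℰ.E = ⊥) (hf : ℰ.f = 1) : ℰ.Btilde ≃ₐ[ℚ_[p]] (Fin ℰ.f → T.BE ℰ.E) :=
  ((Algebra.TensorProduct.congr (AlgEquiv.refl (R := ℚ_[p]) (A₁ := B))
        ((IntermediateField.equivOfEq hE).trans (IntermediateField.botEquiv ℚ_[p] Ω))).trans
      (Algebra.TensorProduct.rid ℚ_[p] ℚ_[p] B)).trans
    (((AlgEquiv.ofInjective T.toBdR T.toBdR_injective).trans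
        (Subalgebra.equivOfEq _ _ (by rw [hE, BE_bot_eq_range]))).trans (ℰ.diagOfEqOne hf))

/-- Hence (5.2.5.4) HOLDS whenever `E = E_0 = ℚ_p`. [folklore] -/
theorem btildeSplits_of_bot (hE : ℰ.E = ⊥) (hf : ℰ.f = 1) : ℰ.BtildeSplits := ⟨ℰ.splitOfBot hE hf⟩

end BEDatum

end Summit.ABC.IUTFork.Joshi.ATS3.PeriodRingTower

namespace Summit.ABC.IUTFork.Joshi.Model

/-! ### §6b (generic) a one-place collation datum and DEGENERATE lift data over any nontrivial ring -/

/-- A one-place collation datum: `V_{L′} = {w}` with `w ∈ V^{odd,ss}`, `|Y| = {pt}`, `|p_w|_{K_y} = 1/2`, empty local Ansatz,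
`ℓ⋇ = l` arbitrary. [folklore] -/
def unitCollation (l : ℕ) : ATS3.CollationDatum where
  lstar := l
  V := Unit
  Voddss := Set.univ
  Y _ := Unit
  normP _ _ := 1 / 2
  normP_pos_lt_one _ _ := ⟨by norm_num, by norm_num⟩
  localAnsatz _ := ∅

section TrivialLift

variable (O R : Type) [CommRing O] [CommRing R] [Algebra O R] [Nontrivial R]

/-- Some maximal ideal `𝔪` of a nontrivial ring. [folklore] -/
def someMaximalIdeal : Ideal R := Classical.choose (Ideal.exists_maximal R)

/-- `𝔪` is maximal. [folklore] -/
theorem isMaximal_someMaximalIdeal : (someMaximalIdeal R).IsMaximal := Classical.choose_spec (Ideal.exists_maximal R)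

/-- `R ⧸ 𝔪` is nontrivial. [folklore] -/
theorem nontrivial_quot_someMaximalIdeal : Nontrivial (R ⧸ someMaximalIdeal R) :=
  Ideal.Quotient.nontrivial_iff.mpr (isMaximal_someMaximalIdeal R).ne_top

open Classical in
/-- DEGENERATE lift data (slot T-10's signature `ThetaLiftDatum`, one point `y′`) over any nontrivial `O`-algebra `R`:
`𝔪_{y′} := 𝔪`, `O_{ℂ_p^♭} := {pt}` with `[pt] := 1` and `|pt| := 1`, all Fréchet norms `≡ 1`, `|q|_{K_{y′}} := 0` if `q = 0` else
`1`, `ξ := 1`, `q_{X/E} := 1`, `t_{y′} := 0`. [folklore] -/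
def trivialLift : ATS3.ThetaLiftDatum O R Unit where
  m _ := someMaximalIdeal R
  m_isMaximal _ := isMaximal_someMaximalIdeal R
  Cflat := Unit
  teich _ := 1
  absFlat _ := 1
  norm _ _ := 1
  norm_teich _ _ _ _ := rfl
  absK _ q := if q = 0 then 0 else 1
  absK_teich _ _ := by
    haveI := nontrivial_quot_someMaximalIdeal R
    rw [map_one, if_neg one_ne_zero]
  xi _ := 1
  tate _ := 1
  tgen _ := 0
  tgen_mem _ := Ideal.zero_mem _

/-- `|0|_{K_{y′}} = 0`. [folklore] -/
theorem trivialLift_absK_zero (y : Unit) : (trivialLift O R).absK y 0 = 0 := if_pos rfl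

open Classical in
/-- `0 < |ξ|_{K_{y′}} = 1`. [folklore] -/
theorem trivialLift_absK_xi_pos (y : Unit) : 0 < (trivialLift O R).absK y ((trivialLift O R).xi y) := by
  haveI := nontrivial_quot_someMaximalIdeal R
  show (0 : ℝ) < if (1 : R ⧸ someMaximalIdeal R) = 0 then 0 else 1
  rw [if_neg one_ne_zero]
  exact one_pos

/-- The §6.4 / §6.10.2 INPUT of p436830's constructor, degenerate: `trivialLift` at the one place, `V_{L_mod} = V`, trivial trace.
[folklore] -/
def trivialLiftInput (l : ℕ) : ATS3.AdelicLiftDatum.LiftInput (unitCollation l) (fun _ => O) (fun _ => R) where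
  lift _ := trivialLift O R
  oneFlat _ := ()
  teich_oneFlat _ := rfl
  absFlat_oneFlat _ := rfl
  absK_zero _ y := trivialLift_absK_zero O R y
  absK_xi_pos _ y := trivialLift_absK_xi_pos O R y
  Vmod := Unit
  sel := id
  sel_injective := Function.injective_id
  Bmod _ := Unit
  trace _ _ := ()

end TrivialLift

/-! ### §6c Instantiation at the tower model -/

variable (p : ℕ) [hp : Fact p.Prime]

/-- Elaboration device: the model datum of p438686 RESTATED as a reducible structure literal (so that instance search sees the
carrier `B_E = B_{ℚ_p}` syntactically); equal to `towerBEDatum p` by `rfl` (next lemma). [folklore] -/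
abbrev modelBEDatum : (towerModel p).BEDatum where
  E := ⊥
  finiteDimensional := (towerBEDatum p).finiteDimensional
  E0 := ⊥
  E0_le := le_rfl
  E0_subset_Bplus := (towerBEDatum p).E0_subset_Bplus
  frobBE := frobBE p
  frobBE_of_mem := (towerBEDatum p).frobBE_of_mem

/-- `modelBEDatum` IS `towerBEDatum`. [folklore] -/
theorem modelBEDatum_eq : modelBEDatum p = towerBEDatum p := rfl

/-- `[E_0 : ℚ_p] = 1` in the model. [folklore] -/
theorem f_modelBEDatum : (modelBEDatum p).f = 1 := IntermediateField.finrank_bot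

/-- The witness `B̃_E ≃ₐ[ℚ_p] (Fin [E_0:ℚ_p] → B_E)` of (5.2.5.4) for the model datum (§6a at `E = E_0 = ℚ_p`; the type is
left to inference on purpose — it is `(modelBEDatum p).Btilde ≃ₐ[ℚ_[p]] (Fin (modelBEDatum p).f → (towerModel p).BE (modelBEDatum p).E)`).
[folklore] -/
def modelSplit := (modelBEDatum p).splitOfBot rfl (f_modelBEDatum p)

/-- The §3–§4 residuals, restated for `modelBEDatum` (definitionally those of `towerBEDatum`). [folklore] -/
theorem residuals_modelBEDatum :
    (∀ c : ℚ_[p], ((algebraMap ℚ_[p] ((towerModel p).BE (modelBEDatum p).E) c :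
        (towerModel p).BE (modelBEDatum p).E) : Omega p) ∈ (modelBEDatum p).E) ∧
    (∀ g : (modelBEDatum p).GE, Continuous ((modelBEDatum p).galBE g)) ∧
    Continuous (modelBEDatum p).frobBE ∧ Continuous (modelBEDatum p).frobBE.symm ∧
    (∀ (g : (modelBEDatum p).GE) (x : (towerModel p).BE (modelBEDatum p).E),
      (modelBEDatum p).galBE g ((modelBEDatum p).frobBE x) = (modelBEDatum p).frobBE ((modelBEDatum p).galBE g x)) :=
  thm671_residuals_towerModel p

/-- **The adelic lift family REALISED on the model carriers** by T-11's constructor `AdelicLiftDatum.ofPeriodRings` (p436830 §C):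
`G := G_E`, `galAct`, `frob := φ_{B_E}`, `Aut(G_E)`-twists, closed convex hull for the `S`-adic topology, `B_E ⊂ B_dR`, `B_E ↪ B̃_E`
all from T-09 at the model; degenerate lift and descent data (§6b) with scalars `O := ℚ_p`. [folklore] -/
def modelAdelic (l : ℕ) :
    ATS3.AdelicLiftDatum (unitCollation l) (fun _ => ℚ_[p]) (fun _ => (towerModel p).BE (modelBEDatum p).E) :=
  ATS3.AdelicLiftDatum.ofPeriodRings (unitCollation l) (fun _ : (unitCollation l).V => modelBEDatum p) (fun _ => ℚ_[p])
    (trivialLiftInput ℚ_[p] ((towerModel p).BE (modelBEDatum p).E) l) (fun _ => modelSplit p)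

/-- **[J-III] Thm. 6.7.1 (1)(2)(3) HOLDS — no hypothesis left — for the realised family over the model**, by T-11's
`thm671_ofPeriodRings_mulActionBE` fed with §3–§4: at the (unique, odd semistable) place the basic theta-values locus
`Θ̃^{B_E}_Joshi` (closed convex hull ∘ Frobenius stabilisation ∘ `Aut(G_E)`-enlargement of the Def. 6.6.1.1 locus of the degenerate
lift data) is Galois stable, `φ`-stable and `Aut(G_E)`-stable — for every prime `p` and every `ℓ⋇`. NON-VACUITY of the conditional
derivation p430072 → p436830; a logical model, nothing more. [folklore] -/
theorem thm671_towerModel (l : ℕ) :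
    letI : ∀ _w : (unitCollation l).V, MulAction (modelBEDatum p).GE ((towerModel p).BE (modelBEDatum p).E) :=
      fun _ => (modelBEDatum p).mulActionBE
    (modelAdelic p l).Thm671 (fun _ => (modelBEDatum p).GE) :=
  ATS3.AdelicLiftDatum.thm671_ofPeriodRings_mulActionBE (unitCollation l) (fun _ => modelBEDatum p) (fun _ => ℚ_[p])
    (trivialLiftInput ℚ_[p] ((towerModel p).BE (modelBEDatum p).E) l) (fun _ => modelSplit p)
    (fun _ => (residuals_modelBEDatum p).1) (fun _ => (residuals_modelBEDatum p).2.1)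
    (fun _ => (residuals_modelBEDatum p).2.2.1) (fun _ => (residuals_modelBEDatum p).2.2.2.1)
    (fun _ => (residuals_modelBEDatum p).2.2.2.2)

end Summit.ABC.IUTFork.Joshi.Model

end
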